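import Literature.NumberTheory.LFunctions.MertensSparseCertificate
import Literature.NumberTheory.LFunctions.MertensSparseCertificateData
import HarnessLib

/-!
# Sparse certificate for the disproof of the Mertens conjecture: block 3 (zeros 376–500)

One compiled evaluation (`native_decide`) of the block checker
`Literature.NumberTheory.LFunctions.ZetaNumerics.SparseCert.checkBlock` (`MertensSparseCertificate.lean`, soundness
`checkBlock_sound`) on the data of `MertensSparseCertificateData.lean`: at scale `2³⁵²`, with
Euler–Maclaurin parameters `N = 680`, `ν = 75`, for the brackets `j = 375, …, 499` — two
certified values of `ζ` per bracket, the twisted sign test, and the lower bound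
`-1337972824467730 · 2⁻⁶⁴` (`≈ 0.00013 − 2·10⁻⁴`) for the partial sum of
`2 Re [k(γ_j/812) e^{iγ_j y} / ((½ + iγ_j) D_j)]` over the block. About one CPU-minute. The only
non-standard axiom is the `native_decide` auxiliary axiom (trust in the Lean compiler), declared
to the gate as `computational`.
-/

namespace Literature.NumberTheory.LFunctions.MertensSparseCertificate.ZetaNumerics.SparseCert

open ZetaNumerics.SparseCertData

/-- Block 3 of the sparse certificate (zeros 376–500):
`checkBlock … 375 125 L_3 = true`. [cite: OdlyzkoTeRiele1985, §4.2–4.3 pp. 151–153] -/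
theorem checkBlock_3 :
    ZetaNumerics.SparseCert.checkBlock ⟨2 ^ 352, 500, ordinates, 2 ^ 52, 812, 1, yNum, 10 ^ 7⟩
      ⟨680, 75, 40, 400, 134, 80, 4, 80, 12⟩ 375 125 (-1337972824467730) = true := by
  native_decide

end Literature.NumberTheory.LFunctions.MertensSparseCertificate.ZetaNumerics.SparseCert
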